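/-
Copyright (c) 2026 the pub-hodgecm-mathlib formalisation cell (harness21).  Prover seat hodgecm-mathlib-LH4-p10 (g6): Track A «(D-RAM) FOUR-FRAME» squad of crux H413, (β) TABLE —
the R2 junction adapter named by chair LH4-r01 (g9) 15:22:48Z («hP2G3_of_cell_and_beyond», owed and unnamed); sub-dealer LH4-p05 (g8); assembler F0P3a-p01 (g37).  2026-09-04.
-/
import Summits.HodgeConjecture.HodgeConjecture.Theorems.F0P3cDyRamFourFramePieces   -- ★ DEFS №3: `mstarOfRecord d = d % 2 + 2d − 1`
import HarnessLib

/-!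
# Crux `H413`, line LH4 «(D-RAM) FOUR-FRAME» — (β) TABLE, the `G₃` ROW ADAPTER: cell currency (★ p861290) + beyond-cell currency ⟹ the trunk's `_hG3t` letter

Cell `hodgecm-mathlib` (D-0151), FLOOR 0, crux item H413 = `stmt-HodgeConjecture-24833`, route `HCCMUnconditional`; squad F0∕P3c∕LH4.  THEOREMS ONLY (pure `ℕ`∕`ℚ` bracket
bookkeeping; no lattice, no law); lane `--supports stmt-HodgeConjecture-24833 --as helper` (count-neutral).

WHAT.  F0P3a-p01 (g37)'s trunk `hbox_of_oddBoxSum` takes the tower-3 glued row as ONE hypothesis `hP2G3` = (T1) ★ p861261's `_hG3t` VERBATIM: for every capped tube class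
`(ρ, s)` (`1 ≤ ρ`, `2ρ + s + ℓ₀ = n₃`, `2 ∣ s`, `2ρ + 2 + ℓ₀ ≤ min n₁ n₂`) the row value is `ω_C∕2 · q^{2ρ+s∕2−1} · (ω_m·b(n₁), b(n₂), 0)_i` with the BRACKET
`b(n) = (q−1)·[2d + ℓ₀ + 2ρ ≤ n] − [n + 2 = 2d + ℓ₀ + 2ρ]`.  The payers deliver it in TWO currencies: the ONE-SLOT CELL `2ρ + m* ≤ n₁` (★ p861290 `…PureStrataG3`, over the
per-lattice read: `[2ρ+s+ℓ₀ = n₃ ∧ 2∣s ∧ 2ρ ≤ min n₁ n₂] · ω_C∕2 · (ω_m(q−1)q^e, q^e((q−1)[2d ≤ s] − [s+2 = 2d]), 0)_i`) and the ε-BOUNDARY classes beyond the cell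
`n₁ < 2ρ + m*` (row R5, LH4-p13 (g8) × LH4-p14 (g6), taken here in `_hG3t`'s own bracket currency).  `hG3t_of_cell_and_beyond` GLUES them into `_hG3t` for an ARBITRARY row
function `V : ℕ → ℕ → ℚ` (the trunk instantiates `V ρ s :=` the common-shape finsum at `![2ρ+s, 2ρ+s, 2ρ]`): case split cell ∕ beyond; in the cell the `n₃`-brackets of the
cell currency equal the `n₁`∕`n₂`-brackets of `_hG3t` by PARITY (`nⱼ ≡ d ≡ ℓ₀`, so `2ρ + m* = n₁` is void) and the ISOSCELES placements (chair LH4-r01 (g9)'s hand check,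
15:22:48Z, made a kernel fact), and `s = 0` is void by isosceles.
HONEST LABEL.  Count-neutral glue; both currencies stay hypotheses of the adapter (the cell one is ★ p861290 modulo (P2a)+shell, the beyond one is R5, OPEN); (β) OPEN; `HC_CM` is
proved only modulo the 7 printed citations (2 remaining named inputs: hLiu418 = `stmt-HodgeConjecture-24832`, h413 = `stmt-HodgeConjecture-24833`) until rung 0 closes.

## References
* [Kottwitz1986BaseChangeUnits] R. E. Kottwitz, *Base change for unit elements of Hecke algebras*, Compositio Math. 60 (1986), §1 pp. 240–241.
* [Rogawski1990] J. D. Rogawski, *Automorphic Representations of Unitary Groups in Three Variables*, Ann. of Math. Stud. 123 (1990), §4.9 Prop. 4.9.1 (a)(b) p. 55.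
-/

set_option autoImplicit false

namespace Summit.HodgeConjecture.HodgeConjecture.Cruxes.H413.F0P3cDyRamOddLabelledG3RowAdapter

open Summit.HodgeConjecture.HodgeConjecture.Cruxes.H413.F0P3cDyRamFourFramePieces (mstarOfRecord)

/-- **THE `G₃` ROW ADAPTER**: the cell head (★ p861290's currency, `1 ≤ s`, cell `2ρ + m* ≤ n₁`, brackets in `s`) and the beyond-cell head (`n₁ < 2ρ + m*`, in `_hG3t`'s bracket
currency) together give (T1) ★ p861261's `_hG3t` letter VERBATIM, for any row function `V`, under the parities `nⱼ ≡ d (mod 2)` and the isosceles shape of the key.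
[cite: Kottwitz1986BaseChangeUnits, §1 pp. 240–241] [cite: Rogawski1990, §4.9 Prop. 4.9.1 (a)(b) p. 55] -/
theorem hG3t_of_cell_and_beyond (V : ℕ → ℕ → ℚ) (q : ℕ) (ωC ωm : ℤ) {d n₁ n₂ n₃ : ℕ}
    (hiso : (n₁ = n₂ ∧ n₁ ≤ n₃) ∨ (n₁ = n₃ ∧ n₁ ≤ n₂) ∨ (n₂ = n₃ ∧ n₂ ≤ n₁))
    (h1 : n₁ % 2 = d % 2) (h2 : n₂ % 2 = d % 2) (h3 : n₃ % 2 = d % 2) (i : Fin 3)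
    (hcell : ∀ ρ s, 1 ≤ ρ → 1 ≤ s → 2 * ρ + mstarOfRecord d ≤ n₁ →
      V ρ s = if 2 * ρ + s + d % 2 = n₃ ∧ 2 ∣ s ∧ 2 * ρ ≤ min n₁ n₂ then
        (ωC : ℚ) / 2 *
          (![(ωm : ℚ) * ((q : ℚ) - 1) * (q : ℚ) ^ (2 * ρ + s / 2 - 1),
              (q : ℚ) ^ (2 * ρ + s / 2 - 1) * ((if 2 * d ≤ s then (q : ℚ) - 1 else 0) - (if s + 2 = 2 * d then 1 else 0)),
              (0 : ℚ)] : Fin 3 → ℚ) i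
      else 0)
    (hbeyond : ∀ ρ s, 1 ≤ ρ → n₁ < 2 * ρ + mstarOfRecord d → 2 * ρ + s + d % 2 = n₃ → 2 ∣ s → 2 * ρ + 2 + d % 2 ≤ min n₁ n₂ →
      V ρ s = (ωC : ℚ) / 2 * (q : ℚ) ^ (2 * ρ + s / 2 - 1) *
        (![(ωm : ℚ) * ((if 2 * d + d % 2 + 2 * ρ ≤ n₁ then (q : ℚ) - 1 else 0) - (if n₁ + 2 = 2 * d + d % 2 + 2 * ρ then 1 else 0)),
            (if 2 * d + d % 2 + 2 * ρ ≤ n₂ then (q : ℚ) - 1 else 0) - (if n₂ + 2 = 2 * d + d % 2 + 2 * ρ then 1 else 0),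
            (0 : ℚ)] : Fin 3 → ℚ) i) :
    ∀ ρ s, 1 ≤ ρ → 2 * ρ + s + d % 2 = n₃ → 2 ∣ s → 2 * ρ + 2 + d % 2 ≤ min n₁ n₂ →
      V ρ s = (ωC : ℚ) / 2 * (q : ℚ) ^ (2 * ρ + s / 2 - 1) *
        (![(ωm : ℚ) * ((if 2 * d + d % 2 + 2 * ρ ≤ n₁ then (q : ℚ) - 1 else 0) - (if n₁ + 2 = 2 * d + d % 2 + 2 * ρ then 1 else 0)),
            (if 2 * d + d % 2 + 2 * ρ ≤ n₂ then (q : ℚ) - 1 else 0) - (if n₂ + 2 = 2 * d + d % 2 + 2 * ρ then 1 else 0),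
            (0 : ℚ)] : Fin 3 → ℚ) i := by
  intro ρ s hρ hP h2s hcap
  by_cases hc : 2 * ρ + mstarOfRecord d ≤ n₁
  swap
  · exact hbeyond ρ s hρ (by omega) hP h2s hcap
  -- IN THE CELL: `s ≥ 2` by isosceles, then the cell currency's `n₃`-brackets are the `n₁`∕`n₂`-brackets by parity + isosceles
  have hc' : 2 * ρ + (d % 2 + 2 * d - 1) ≤ n₁ := hc
  have hmin : min n₁ n₂ ≤ n₃ := by rcases hiso with ⟨h, h'⟩ | ⟨h, h'⟩ | ⟨h, h'⟩ <;> simp only [min_le_iff] <;> omega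
  have hs : 1 ≤ s := by omega
  obtain ⟨k, rfl⟩ := h2s
  rw [hcell ρ (2 * k) hρ hs hc, if_pos ⟨hP, ⟨k, rfl⟩, by omega⟩]
  have hb1 : 2 * d + d % 2 + 2 * ρ ≤ n₁ := by omega
  have hb1' : ¬ (n₁ + 2 = 2 * d + d % 2 + 2 * ρ) := by omega
  have e2k : 2 * k / 2 = k := by omega
  fin_cases i
  · simp only [Fin.zero_eta, Fin.isValue, Matrix.cons_val_zero, if_pos hb1, if_neg hb1', sub_zero, e2k]
    ring
  · simp only [Fin.mk_one, Fin.isValue, Matrix.cons_val_one, Matrix.cons_val_zero, e2k]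
    by_cases hA : 2 * d ≤ 2 * k
    · have hB : 2 * d + d % 2 + 2 * ρ ≤ n₂ := by rcases hiso with ⟨h, h'⟩ | ⟨h, h'⟩ | ⟨h, h'⟩ <;> omega
      rw [if_pos hA, if_neg (by omega), if_pos hB, if_neg (by omega)]
      ring
    · have hB : ¬ (2 * d + d % 2 + 2 * ρ ≤ n₂) := by rcases hiso with ⟨h, h'⟩ | ⟨h, h'⟩ | ⟨h, h'⟩ <;> omega
      rw [if_neg hA, if_neg hB]
      by_cases hC : 2 * k + 2 = 2 * d
      · have hD : n₂ + 2 = 2 * d + d % 2 + 2 * ρ := by rcases hiso with ⟨h, h'⟩ | ⟨h, h'⟩ | ⟨h, h'⟩ <;> omega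
        rw [if_pos hC, if_pos hD]
        ring
      · have hD : ¬ (n₂ + 2 = 2 * d + d % 2 + 2 * ρ) := by rcases hiso with ⟨h, h'⟩ | ⟨h, h'⟩ | ⟨h, h'⟩ <;> omega
        rw [if_neg hC, if_neg hD]
        ring
  · simp only [Fin.reduceFinMk, Matrix.cons_val_two, Matrix.tail_cons, Matrix.head_cons]
    ring

end Summit.HodgeConjecture.HodgeConjecture.Cruxes.H413.F0P3cDyRamOddLabelledG3RowAdapter
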